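import Mathlib
import Summits.KontsevichZagierPeriods.KontsevichZagierPeriods.Theses.HyperbolicBloch
import Literature.NumberTheory.Transcendental.ZagierDilogarithmConjecture
import Literature.NumberTheory.Transcendental.BlochWignerDilogarithm
import Literature.NumberTheory.Transcendental.BlochWignerDilogarithmVolumeProofs
import Literature.NumberTheory.Transcendental.PreBlochRelationCriterion
import Summits.KontsevichZagierPeriods.KontsevichZagierPeriods.Theorems.ZagierDilogarithmConjecture.Negative.DehnInvariant
import Summits.KontsevichZagierPeriods.KontsevichZagierPeriods.Theorems.HyperbolicBlochZagierDilogarithmConjectureGaloisRegulator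
import Summits.KontsevichZagierPeriods.KontsevichZagierPeriods.Theorems.HyperbolicBlochZagierDilogarithmConjectureStubGaloisDescent
import Summits.KontsevichZagierPeriods.KontsevichZagierPeriods.Theorems.HyperbolicBlochZagierDilogarithmConjectureStubSelfSimilar
import Summits.KontsevichZagierPeriods.KontsevichZagierPeriods.Theorems.HyperbolicBlochZagierDilogarithmConjectureStubBiquadraticSymmetric
import Summits.KontsevichZagierPeriods.KontsevichZagierPeriods.Theorems.HyperbolicBlochZagierDilogarithmConjectureStubSignedPermutation
import Summits.KontsevichZagierPeriods.KontsevichZagierPeriods.Theorems.HyperbolicBlochZagierDilogarithmConjectureStubOnePlaceSigned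
import Summits.KontsevichZagierPeriods.KontsevichZagierPeriods.Theorems.HyperbolicBlochZagierDilogarithmConjectureStubCyclotomicPoints
import Summits.KontsevichZagierPeriods.KontsevichZagierPeriods.Theorems.HyperbolicBlochZagierDilogarithmConjectureStubMonomialSymmetric
import Summits.KontsevichZagierPeriods.KontsevichZagierPeriods.Theorems.HyperbolicBlochZagierDilogarithmConjectureStubCyclotomicSigned
import Summits.KontsevichZagierPeriods.KontsevichZagierPeriods.Theorems.HyperbolicBlochZagierDilogarithmConjectureStubBiquadraticSigned
import HarnessLib

/-!
# `ZagierDilogarithmConjecture` (stmt-KontsevichZagierPeriods-10550) — line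
`kummer-clausen-linearisation` (reshape c2, "Galois descent"): the slices and the exactness of the reshape

The compositions of the line's closed stubs, as importable theorems (registered stub:
`stub_cyclotomicSignedSlice`). Every slice is conditional on exactly ONE printed theorem, Dupont 2001
Thm. 10.24 a) (Borel's regulator theorem + Suslin; Literature named fact
`Dupont2001_preBloch_relation_of_invariants`, an explicit hypothesis `hD`), and says: a `ℤ`-relation
`Σ nᵢ D(zᵢ) = 0` among Bloch–Wigner values at algebraic points of `ℍ⁺` whose formal combination
`β = Σ nᵢ[zᵢ]` has zero Dehn invariant and carries the respective COMBINATORIAL certificate of Galois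
propagation is explained (`β ∈ ⟨dilogRelators⟩`):

* `borelSlice_of_galoisDescent` — points in a number field every embedding of which is the inclusion, its
  conjugate, or real (lead c1's Borel slice, re-derived through the c2 engine);
* `biquadraticSlice`, `biquadraticSignedSlice` — points of `ℚ(√e, √−d)`, combination (signed-)symmetric under
  `τ : √e ↦ −√e`;
* `cyclotomicSlice`, `stub_cyclotomicSignedSlice` — cyclotomic points `Σ qᵢₘ ζ_Nᵐ`, combination
  (signed-)symmetric under `ζ ↦ ζʲ` for every `j` coprime to `N` (e.g. `H`-orbit sums, `H ≤ (ℤ/N)ˣ` of index 2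
  with `−1 ∉ H`, together with points of the imaginary quadratic field `ℚ(ζ_N)^H`).

Exactness: `galoisPropagation_of_crux` (the crux implies Galois propagation) and `crux_iff_residual` (given
Dupont, the crux is EQUIVALENT to the conjunction of the two open stubs `stub_symbolPart` — non-zero Dehn
invariant ⇒ `Σ nᵢ D(zᵢ) ≠ 0` — and `stub_galoisPropagation` — Dehn zero ∧ `Σ nᵢ D(zᵢ) = 0` ⇒ propagation).
-/

noncomputable section

open scoped BigOperators ComplexConjugate
open Literature.NumberTheory.Transcendental
open Summit.KontsevichZagierPeriods.HyperbolicBloch.ZagierDilogarithmConjectureNegative (dehn)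
open Summit.KontsevichZagierPeriods.KontsevichZagierPeriods (Theses.HyperbolicBloch.ZagierDilogarithmConjecture)

namespace Summit.KontsevichZagierPeriods.HyperbolicBloch.ZagierDilogarithmGaloisDescent

open Summit.KontsevichZagierPeriods.HyperbolicBloch.ZagierDilogarithm
  (exists_galoisRegulator galoisRegulator_sum_zsmul_of galoisRegulator_eq_zero_of_mem_closure)

/-- The route decl is verbatim the inline form of the named open conjecture. [folklore] -/
theorem cruxIff :
    Theses.HyperbolicBloch.ZagierDilogarithmConjecture ↔ ZagierDilogarithmRelationsConjecture := by
  constructor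
  · intro h
    exact ZagierDilogarithmRelationsConjecture.of_inline idealTetrahedron (fun z => rfl)
      (h idealTetrahedron (fun z => rfl))
  · intro h T hT
    exact h.inline T hT


/-- The crux implies Galois propagation (soundness of the open stub): an explained combination is
killed by every Galois-twisted odd regulator `[x] ↦ D(σx) − D(σx̄)` (`exists_galoisRegulator`,
`galoisRegulator_eq_zero_of_mem_closure`, gen 2). [folklore] -/
theorem galoisPropagation_of_crux (h : Theses.HyperbolicBloch.ZagierDilogarithmConjecture) :
    ∀ (k : ℕ) (z : Fin k → ℂ) (n : Fin k → ℤ), (∀ i, IsAlgebraic ℚ (z i)) → (∀ i, 0 < (z i).im) →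
      ∑ i, (n i : ℝ) * blochWignerDilog (z i) = 0 →
        ∀ (σ : ↥(algebraicClosure ℚ ℂ) →ₐ[ℚ] ℂ) (w w' : Fin k → ↥(algebraicClosure ℚ ℂ)),
          (∀ i, (w i : ℂ) = z i) → (∀ i, (w' i : ℂ) = conj (z i)) →
          ∑ i, (n i : ℝ) * (blochWignerDilog (σ (w i)) - blochWignerDilog (σ (w' i))) = 0 := by
  intro k z n halg him hsum σ w w' hw hw'
  have hD := ZagierDilogarithmRelationsConjecture.iff_blochWignerDilog'.1 (cruxIff.1 h)
  obtain ⟨g, hg, hg'⟩ := exists_galoisRegulator σ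
  rw [← galoisRegulator_sum_zsmul_of g hg z n w w' hw hw']
  exact galoisRegulator_eq_zero_of_mem_closure g hg (fun x _ hx => hg' x hx)
    (hD k z n halg him hsum)

/-- **Exactness of the reshape.** Given Dupont's theorem, the crux is EQUIVALENT to the conjunction of
the two open stubs `stub_symbolPart` and `stub_galoisPropagation`. [folklore] -/
theorem crux_iff_residual (hD : Dupont2001_preBloch_relation_of_invariants) :
    Theses.HyperbolicBloch.ZagierDilogarithmConjecture ↔
      ((∀ (k : ℕ) (z : Fin k → ℂ) (n : Fin k → ℤ), (∀ i, IsAlgebraic ℚ (z i)) → (∀ i, 0 < (z i).im) →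
          (∃ u v : Additive ℂˣ →+ ℚ, dehn u v (∑ i, n i • FreeAbelianGroup.of (z i)) ≠ 0) →
          ∑ i, (n i : ℝ) * blochWignerDilog (z i) = 0 →
            (∑ i, n i • FreeAbelianGroup.of (z i)) ∈ AddSubgroup.closure dilogRelators) ∧
        (∀ (k : ℕ) (z : Fin k → ℂ) (n : Fin k → ℤ), (∀ i, IsAlgebraic ℚ (z i)) → (∀ i, 0 < (z i).im) →
          (∀ u v : Additive ℂˣ →+ ℚ, dehn u v (∑ i, n i • FreeAbelianGroup.of (z i)) = 0) →
          ∑ i, (n i : ℝ) * blochWignerDilog (z i) = 0 →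
            ∀ (σ : ↥(algebraicClosure ℚ ℂ) →ₐ[ℚ] ℂ) (w w' : Fin k → ↥(algebraicClosure ℚ ℂ)),
              (∀ i, (w i : ℂ) = z i) → (∀ i, (w' i : ℂ) = conj (z i)) →
              ∑ i, (n i : ℝ) * (blochWignerDilog (σ (w i)) - blochWignerDilog (σ (w' i))) = 0)) := by
  constructor
  · intro h
    have hD' := ZagierDilogarithmRelationsConjecture.iff_blochWignerDilog'.1 (cruxIff.1 h)
    exact ⟨fun k z n halg him _ hsum => hD' k z n halg him hsum,
      fun k z n halg him _ hsum => galoisPropagation_of_crux h k z n halg him hsum⟩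
  · rintro ⟨hS, hP⟩
    refine cruxIff.2 (ZagierDilogarithmRelationsConjecture.iff_blochWignerDilog'.2 ?_)
    intro k z n halg him hsum
    by_cases hS' : ∃ u v : Additive ℂˣ →+ ℚ, dehn u v (∑ i, n i • FreeAbelianGroup.of (z i)) ≠ 0
    · exact hS k z n halg him hS' hsum
    · have hS'' : ∀ u v : Additive ℂˣ →+ ℚ, dehn u v (∑ i, n i • FreeAbelianGroup.of (z i)) = 0 := by
        intro u v
        by_contra hc
        exact hS' ⟨u, v, hc⟩
      exact stub_galoisDescent hD k z n halg him hS'' (hP k z n halg him hS'' hsum)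

/-- `√m` (`m ∈ ℕ`) is algebraic over `ℚ`. [folklore] -/
theorem isAlgebraic_sqrt_nat (m : ℕ) : IsAlgebraic ℚ ((Real.sqrt m : ℝ) : ℂ) := by
  refine ⟨Polynomial.X ^ 2 - Polynomial.C (m : ℚ), ?_, ?_⟩
  · exact Polynomial.X_pow_sub_C_ne_zero (by norm_num) _
  · have h : ((Real.sqrt m : ℝ) : ℂ) ^ 2 = (m : ℂ) := by
      rw [← Complex.ofReal_pow, Real.sq_sqrt (Nat.cast_nonneg m)]
      push_cast
      rfl
    simp [h]

/-- **The biquadratic slice (`r₂ = 2`), mod Dupont.** A Dehn-zero relation `Σ nᵢ D(zᵢ) = 0` among points of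
`ℚ(√e, √−d) ∩ ℍ⁺` that is symmetric under `τ : √e ↦ −√e` is explained by the dilogarithm relators —
composed from `stub_biquadraticSymmetric`, `stub_selfSimilar` and `stub_galoisDescent`. [folklore] -/
theorem biquadraticSlice (hD : Dupont2001_preBloch_relation_of_invariants) :
    ∀ (d e : ℕ) (k : ℕ) (z : Fin k → ℂ) (n : Fin k → ℤ) (a b c f : Fin k → ℚ) (π : Equiv.Perm (Fin k)),
      (∀ i, z i = a i + b i * (Real.sqrt e : ℂ) +
        (c i + f i * (Real.sqrt e : ℂ)) * ((Real.sqrt d : ℂ) * Complex.I)) →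
      (∀ i, n (π i) = n i ∧ a (π i) = a i ∧ b (π i) = -b i ∧ c (π i) = c i ∧ f (π i) = -f i) →
      (∀ i, 0 < (z i).im) →
      (∀ u v : Additive ℂˣ →+ ℚ, dehn u v (∑ i, n i • FreeAbelianGroup.of (z i)) = 0) →
      ∑ i, (n i : ℝ) * blochWignerDilog (z i) = 0 →
        (∑ i, n i • FreeAbelianGroup.of (z i)) ∈ AddSubgroup.closure dilogRelators := by
  intro d e k z n a b c f π hz hπ him hdehn hsum
  have halg : ∀ i, IsAlgebraic ℚ (z i) := by
    intro i
    rw [hz i]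
    refine IsAlgebraic.add (IsAlgebraic.add (isAlgebraic_algebraMap (a i : ℚ)) ?_) ?_
    · exact (isAlgebraic_algebraMap (b i : ℚ)).mul (isAlgebraic_sqrt_nat e)
    · refine IsAlgebraic.mul ?_ ((isAlgebraic_sqrt_nat d).mul ?_)
      · exact (isAlgebraic_algebraMap (c i : ℚ)).add
          ((isAlgebraic_algebraMap (f i : ℚ)).mul (isAlgebraic_sqrt_nat e))
      · exact ⟨Polynomial.X ^ 2 + 1, Polynomial.X_pow_add_C_ne_zero (by norm_num) 1, by simp⟩
  exact stub_galoisDescent hD k z n halg him hdehn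
    (stub_selfSimilar k z n (stub_biquadraticSymmetric d e k z n a b c f π hz hπ) hsum)

/-- **The cyclotomic-orbit slice, mod Dupont.** A Dehn-zero relation `Σ nᵢ D(zᵢ) = 0` among cyclotomic points
`zᵢ = Σₘ qᵢₘ ζᵐ ∈ ℚ(ζ_N) ∩ ℍ⁺` that is orbit-symmetric in the sense of `stub_cyclotomicPoints` is explained by the
dilogarithm relators — composed from `stub_cyclotomicPoints`, `stub_signedPermutation`, `stub_selfSimilar` and
`stub_galoisDescent`. [folklore] -/
theorem cyclotomicSlice (hD : Dupont2001_preBloch_relation_of_invariants) :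
    ∀ (N : ℕ), 0 < N → ∀ (k : ℕ) (z : Fin k → ℂ) (n : Fin k → ℤ) (q : Fin k → Fin N → ℚ),
      (∀ i, z i = ∑ m : Fin N, (q i m : ℂ) *
        Complex.exp (2 * Real.pi * Complex.I / N) ^ (m : ℕ)) →
      (∀ j : ℕ, j.Coprime N →
        (∃ π : Equiv.Perm (Fin k), (∀ i, n (π i) = n i) ∧ ∀ i,
            (∑ m : Fin N, (q i m : ℂ) * Complex.exp (2 * Real.pi * Complex.I / N) ^ (j * (m : ℕ))) =
              z (π i)) ∨
        (∃ π : Equiv.Perm (Fin k), (∀ i, n (π i) = n i) ∧ ∀ i,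
            (∑ m : Fin N, (q i m : ℂ) * Complex.exp (2 * Real.pi * Complex.I / N) ^ (j * (m : ℕ))) =
              conj (z (π i)))) →
      (∀ i, 0 < (z i).im) →
      (∀ u v : Additive ℂˣ →+ ℚ, dehn u v (∑ i, n i • FreeAbelianGroup.of (z i)) = 0) →
      ∑ i, (n i : ℝ) * blochWignerDilog (z i) = 0 →
        (∑ i, n i • FreeAbelianGroup.of (z i)) ∈ AddSubgroup.closure dilogRelators := by
  intro N hN k z n q hz hsym him hdehn hsum
  have hζ : IsAlgebraic ℚ (Complex.exp (2 * Real.pi * Complex.I / N)) := by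
    refine ⟨Polynomial.X ^ N - 1, Polynomial.X_pow_sub_C_ne_zero hN 1, ?_⟩
    have h1 : Complex.exp (2 * Real.pi * Complex.I / N) ^ N = 1 :=
      (Complex.isPrimitiveRoot_exp N hN.ne').pow_eq_one
    simp [h1]
  have halg : ∀ i, IsAlgebraic ℚ (z i) := by
    intro i
    rw [hz i]
    exact Finset.sum_induction _ (fun x => IsAlgebraic ℚ x) (fun _ _ => IsAlgebraic.add)
      isAlgebraic_zero (fun m _ => (isAlgebraic_algebraMap (q i m : ℚ)).mul (hζ.pow _))
  exact stub_galoisDescent hD k z n halg him hdehn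
    (stub_selfSimilar k z n (stub_signedPermutation k z n
      (stub_cyclotomicPoints N hN k z n q hz hsym)) hsum)

/-- **The Borel slice re-derived** (c1's `stub_borelSlice`, p100860) as an instance of the c2 engine:
`stub_galoisDescent ∘ stub_selfSimilar ∘ stub_signedPermutation ∘ stub_onePlaceSigned`. [folklore] -/
theorem borelSlice_of_galoisDescent (hD : Dupont2001_preBloch_relation_of_invariants) :
    ∀ (k : ℕ) (z : Fin k → ℂ) (n : Fin k → ℤ), (∀ i, IsAlgebraic ℚ (z i)) → (∀ i, 0 < (z i).im) →
      (∀ u v : Additive ℂˣ →+ ℚ, dehn u v (∑ i, n i • FreeAbelianGroup.of (z i)) = 0) →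
      (∃ K : IntermediateField ℚ ℂ, FiniteDimensional ℚ K ∧ (∀ i, z i ∈ K) ∧
          ∀ σ : K →+* ℂ, (∀ x : K, σ x = (x : ℂ)) ∨ (∀ x : K, σ x = (starRingEnd ℂ) (x : ℂ)) ∨
            (∀ x : K, (σ x).im = 0)) →
      ∑ i, (n i : ℝ) * blochWignerDilog (z i) = 0 →
        (∑ i, n i • FreeAbelianGroup.of (z i)) ∈ AddSubgroup.closure dilogRelators :=
  fun k z n halg him hdehn hK hsum =>
    stub_galoisDescent hD k z n halg him hdehn
      (stub_selfSimilar k z n (stub_signedPermutation k z n (stub_onePlaceSigned k z n hK)) hsum)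

/-- **The signed cyclotomic slice, mod Dupont** — `ℍ⁺`-normalised orbit-symmetric relations over `ℚ(ζ_N)`
with zero Dehn invariant are explained: `stub_cyclotomicSigned ∘ stub_monomialSymmetric ∘ stub_selfSimilar ∘
stub_galoisDescent`. [folklore] -/
theorem stub_cyclotomicSignedSlice :
    Dupont2001_preBloch_relation_of_invariants →
    ∀ (N : ℕ), 0 < N → ∀ (k : ℕ) (z : Fin k → ℂ) (n : Fin k → ℤ) (q : Fin k → Fin N → ℚ),
      (∀ i, z i = ∑ m : Fin N, (q i m : ℂ) *
        Complex.exp (2 * Real.pi * Complex.I / N) ^ (m : ℕ)) →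
      (∀ j : ℕ, j.Coprime N → ∃ (e : ℤ) (π : Equiv.Perm (Fin k)), ∀ i,
          ((∑ m : Fin N, (q i m : ℂ) * Complex.exp (2 * Real.pi * Complex.I / N) ^ (j * (m : ℕ))) =
              z (π i) ∧ n i = e * n (π i)) ∨
          ((∑ m : Fin N, (q i m : ℂ) * Complex.exp (2 * Real.pi * Complex.I / N) ^ (j * (m : ℕ))) =
              conj (z (π i)) ∧ n i = -(e * n (π i)))) →
      (∀ i, 0 < (z i).im) →
      (∀ u v : Additive ℂˣ →+ ℚ, dehn u v (∑ i, n i • FreeAbelianGroup.of (z i)) = 0) →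
      ∑ i, (n i : ℝ) * blochWignerDilog (z i) = 0 →
        (∑ i, n i • FreeAbelianGroup.of (z i)) ∈ AddSubgroup.closure dilogRelators := by
  intro hD N hN k z n q hz hsym him hdehn hsum
  have hζ : IsAlgebraic ℚ (Complex.exp (2 * Real.pi * Complex.I / N)) := by
    refine ⟨Polynomial.X ^ N - 1, Polynomial.X_pow_sub_C_ne_zero hN 1, ?_⟩
    have h1 : Complex.exp (2 * Real.pi * Complex.I / N) ^ N = 1 :=
      (Complex.isPrimitiveRoot_exp N hN.ne').pow_eq_one
    simp [h1]
  have halg : ∀ i, IsAlgebraic ℚ (z i) := by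
    intro i
    rw [hz i]
    exact Finset.sum_induction _ (fun x => IsAlgebraic ℚ x) (fun _ _ => IsAlgebraic.add)
      isAlgebraic_zero (fun m _ => (isAlgebraic_algebraMap (q i m : ℚ)).mul (hζ.pow _))
  exact stub_galoisDescent hD k z n halg him hdehn
    (stub_selfSimilar k z n (stub_monomialSymmetric k z n
      (stub_cyclotomicSigned N hN k z n q hz hsym)) hsum)

/-- **The signed biquadratic slice, mod Dupont** — `ℍ⁺`-normalised `τ`-symmetric relations over `ℚ(√e, √−d)`
with zero Dehn invariant are explained: `stub_biquadraticSigned ∘ stub_monomialSymmetric ∘ stub_selfSimilar ∘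
stub_galoisDescent`. [folklore] -/
theorem biquadraticSignedSlice (hD : Dupont2001_preBloch_relation_of_invariants) :
    ∀ (d e : ℕ) (k : ℕ) (z : Fin k → ℂ) (n : Fin k → ℤ) (a b c f : Fin k → ℚ),
      (∀ i, z i = a i + b i * (Real.sqrt e : ℂ) +
        (c i + f i * (Real.sqrt e : ℂ)) * ((Real.sqrt d : ℂ) * Complex.I)) →
      (∃ (E : ℤ) (π : Equiv.Perm (Fin k)), ∀ i,
          ((a i : ℂ) - b i * (Real.sqrt e : ℂ) +
              (c i - f i * (Real.sqrt e : ℂ)) * ((Real.sqrt d : ℂ) * Complex.I) = z (π i) ∧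
            n i = E * n (π i)) ∨
          ((a i : ℂ) - b i * (Real.sqrt e : ℂ) +
              (c i - f i * (Real.sqrt e : ℂ)) * ((Real.sqrt d : ℂ) * Complex.I) = conj (z (π i)) ∧
            n i = -(E * n (π i)))) →
      (∀ i, 0 < (z i).im) →
      (∀ u v : Additive ℂˣ →+ ℚ, dehn u v (∑ i, n i • FreeAbelianGroup.of (z i)) = 0) →
      ∑ i, (n i : ℝ) * blochWignerDilog (z i) = 0 →
        (∑ i, n i • FreeAbelianGroup.of (z i)) ∈ AddSubgroup.closure dilogRelators := by
  intro d e k z n a b c f hz hτ him hdehn hsum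
  have halg : ∀ i, IsAlgebraic ℚ (z i) := by
    intro i
    rw [hz i]
    refine IsAlgebraic.add (IsAlgebraic.add (isAlgebraic_algebraMap (a i : ℚ)) ?_) ?_
    · exact (isAlgebraic_algebraMap (b i : ℚ)).mul (isAlgebraic_sqrt_nat e)
    · refine IsAlgebraic.mul ?_ ((isAlgebraic_sqrt_nat d).mul ?_)
      · exact (isAlgebraic_algebraMap (c i : ℚ)).add
          ((isAlgebraic_algebraMap (f i : ℚ)).mul (isAlgebraic_sqrt_nat e))
      · exact ⟨Polynomial.X ^ 2 + 1, Polynomial.X_pow_add_C_ne_zero (by norm_num) 1, by simp⟩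
  exact stub_galoisDescent hD k z n halg him hdehn
    (stub_selfSimilar k z n (stub_monomialSymmetric k z n
      (stub_biquadraticSigned d e k z n a b c f hz hτ)) hsum)


end Summit.KontsevichZagierPeriods.HyperbolicBloch.ZagierDilogarithmGaloisDescent

end
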